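import Mathlib
import HarnessLib
import Literature.Probability.MarkovChains.MetropolisHastings

/-!
# The over-heat-bath move is reversible: fresh draw of one factor, measure-preserving involution on the other

HONEST FRAMING: exact (Metropolis-corrected) sampling algorithms for lattice gauge theory;
figures of merit are autocorrelation/cost numbers at stated couplings and volumes; no
continuum-physics claim.

Venture `LatticeQCDFlow` (cell pub-lqcd), topic `Exactness`; FANOUT row 9 (`eng-latcore`, the
`latflow.core` engine: `cpn_2d` update mode `'over'`, 0.2.1).  NEW WORK of the cell (elementary
finite sums); the printed name "over-heat-bath" (Petronzio–Vicari; Bonanno–Nada–Vadacchino 2024 use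
it for 2D CP(N-1)) appears in docstrings only, nothing is cited as a fact.

## Content

The conditional law of ONE lattice variable given its neighbours factorises as a product
`π (a, b) = p a · q b` of two independent coordinates: for a CP(N-1) site, `a` = the component
`w = Re⟨m̂, z⟩` along the local field (density `∝ e^{κ w} (1 - w²)^{(d-3)/2}`) and `b` = the unit
vector of the perpendicular part (uniform on a sphere); for a U(1) link, `a = |δ|` and `b = sign δ`
of the deviation from the local-field phase (von Mises, symmetric).  The ordinary heat bath redraws
both; the OVER-heat-bath redraws `a` from `p` and applies a FIXED INVOLUTION `σ` to `b`
(`v̂ ↦ -v̂`, `sign ↦ -sign`) that preserves `q`.  On finite types: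

* `overHeatBathKernel p σ (a, b) (a', b') = p a' · [b' = σ b]`;
* `overHeatBathKernel_detailedBalance` — if `σ` is an involution with `q ∘ σ = q`, the kernel is in
  detailed balance with `π (a, b) = p a · q b` (hence `π`-stationary, and its own `π`-adjoint, so it
  may sit inside forward / reversed sequential scans like any heat-bath step);
* `overHeatBathKernel_sum_eq_one`, `overHeatBathKernel_nonneg` — it is a stochastic kernel when `p`
  is a probability vector.

Dictionary: `latflow.core.cpn_2d.sweep(f, beta, 'over', rng)` (C `cpn_kernel.c` mode 4 and the numpy
path) is this move applied site by site and link by link; the full-lattice statement follows from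
the frozen-block lemma (`LocalUpdates.blockKernel_detailedBalance`) and the scan lemmas
(`SequentialScanAdjoint.lean`).
-/

namespace Summit.Ventures.LatticeQCDFlow.Exactness

open Finset
open Literature.Probability.MarkovChains

variable {A B : Type*} [Fintype A] [Fintype B] [DecidableEq B]

/-- The over-heat-bath move on a product `A × B`: redraw the first coordinate from `p`
(independently of the current state) and map the second by the fixed map `σ`. -/
noncomputable def overHeatBathKernel (p : A → ℝ) (σ : B → B) (x y : A × B) : ℝ :=
  p y.1 * (if y.2 = σ x.2 then 1 else 0)

omit [Fintype A] [Fintype B] in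
/-- **Detailed balance of the over-heat-bath move.**  If `σ` is an involution preserving the
second marginal `q`, then `overHeatBathKernel p σ` is reversible with respect to the product weight
`π (a, b) = p a · q b`. -/
theorem overHeatBathKernel_detailedBalance (p : A → ℝ) (q : B → ℝ) (σ : B → B)
    (hσ : Function.Involutive σ) (hq : ∀ b, q (σ b) = q b) :
    DetailedBalance (fun x : A × B => p x.1 * q x.2) (overHeatBathKernel p σ) := by
  rintro ⟨a, b⟩ ⟨a', b'⟩
  unfold overHeatBathKernel
  by_cases h : b' = σ b
  · subst h
    rw [if_pos rfl, if_pos (hσ b).symm]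
    simp only [hq b]
    ring
  · have h' : ¬ b = σ b' := fun e => h (by rw [e, hσ b'])
    rw [if_neg h, if_neg h']
    simp only [mul_zero]

/-- Row sums: the over-heat-bath move is stochastic when `p` is a probability vector. -/
theorem overHeatBathKernel_sum_eq_one {p : A → ℝ} (hp : ∑ a, p a = 1) (σ : B → B)
    (x : A × B) : ∑ y, overHeatBathKernel p σ x y = 1 := by
  unfold overHeatBathKernel
  rw [← Finset.univ_product_univ, Finset.sum_product]
  have inner : ∀ a : A, ∑ b : B, p a * (if b = σ x.2 then (1 : ℝ) else 0) = p a := by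
    intro a
    rw [← Finset.mul_sum, Finset.sum_ite_eq' Finset.univ (σ x.2)]
    simp
  simp_rw [inner, hp]

omit [Fintype A] [Fintype B] in
/-- Non-negativity. -/
theorem overHeatBathKernel_nonneg {p : A → ℝ} (hp : ∀ a, 0 ≤ p a) (σ : B → B) (x y : A × B) :
    0 ≤ overHeatBathKernel p σ x y := by
  unfold overHeatBathKernel
  exact mul_nonneg (hp y.1) (by split_ifs <;> norm_num)

/-- With `σ = id` nothing is claimed beyond the heat bath of the first factor at frozen second
factor; with an involution `σ ≠ id` (the reflection `v̂ ↦ -v̂`) the move is the over-heat-bath —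
either way it is `π`-stationary. -/
theorem overHeatBathKernel_isStationary (p : A → ℝ) (q : B → ℝ) (σ : B → B)
    (hσ : Function.Involutive σ) (hq : ∀ b, q (σ b) = q b) (hp : ∑ a, p a = 1) :
    IsStationary (fun x : A × B => p x.1 * q x.2) (overHeatBathKernel p σ) :=
  (overHeatBathKernel_detailedBalance p q σ hσ hq).isStationary
    (overHeatBathKernel_sum_eq_one hp σ)

end Summit.Ventures.LatticeQCDFlow.Exactness
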